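import Literature.AnabelianGeometry.EtaleTheta.XuuCocycleOfSectionOneFacts
import HarnessLib

/-!
# [EtTh] Rmk. 2.6.1 / Prop. 2.2 (ii) in the §1 model: the constructed `X̲̲ → X̲` is GALOIS when `μ_l ⊆ K`
# (normality `Π^tp_X̲̲ ⊴ Π^tp_X̲` of the cocycle zero set)

Mochizuki, *The étale theta function and its Frobenioid-theoretic manifestations*, Publ. RIMS **45**
(2009): Rmk. 2.6.1 (PRIMS PDF p. 40) "Suppose, for simplicity, that `K` contains a primitive `l`-th root
of unity. Then … `Aut_K(X̲̲^log) = μ_l × {±1}`"; Prop. 2.2 (ii) (p. 37: `X̲̲ → X̲` from a splitting of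
`D_x ↠ G_K`; conjugating the splitting by `t ∈ Δ̄_Θ` multiplies it by `t^{1−χ(g)}`, `χ` the mod-`l`
cyclotomic character) [cite: MochizukiEtTh2009, Rmk 2.6.1 p.40].

Cell abc-iut, layer L2, item N3 (seat abc-iut-L2-t7), row R22′ of abc-iut-L2-lead (gen 3) 2026-08-26:
the NORMALITY binder `hN : (C.Huu.subgroupOf (D.GtpXu l)).Normal` ("`Π^tp_X̲̲ ⊴ Π^tp_X̲`", index `l`) of
seat abc-iut-L6-t19's [EtTh] Rmk. 2.3.1 chain, AT THE `X̲̲` CONSTRUCTED in this seat's chain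
(`XuuCocycle.lean` … `XuuCocycleOfSectionOneFacts.lean`: `Π^tp_X̲̲ :=` the zero set of a continuous 1-cocycle
`F̄ : Π^tp_X̲ → Δ̄_Θ = Δ_Θ/l·Δ_Θ`). As abc-iut-w4-d014 observed (2026-08-26T04:21Z), `hN` is NOT a property
of an arbitrary `DoubleUnderline` (the structure records images and indices only); for the cocycle
construction it holds exactly when `Π^tp_X̲` acts TRIVIALLY on `Δ̄_Θ` — then `F̄` is a homomorphism and its
zero set a kernel — and that action is trivial iff the mod-`l` cyclotomic character of `G_K` is trivial,
i.e. **`μ_l ⊆ K`** (print's standing simplification in Rmk. 2.6.1; in IUT the relevant torsion is rational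
by the initial Θ-data). PROOF-ONLY (0 definitions):

* `galMuN_aug_eq_self_of_muN_subset` — `μ_N ⊆ K` ⇒ `G_K = aug(Π^tp_X)` acts trivially on `μ_N`;
* `conj_mul_inv_mem_lDeltaTheta_of_muN_subset` — with the cyclotome identification `Δ_Θ/l ≅ μ_l`
  (seat abc-iut-L2-t8's `CyclotomeMod 1 l`, `G_K`-equivariant by its field `red_conj`), `μ_l ⊆ K` ⇒ `Π^tp_X`
  acts trivially on `Δ_Θ/l·Δ_Θ`;
* `XuuCocycleData.Huu0_normal_of_triv`, `…doubleUnderline_normal_of_muL` — the zero set is normal;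
* `exists_doubleUnderline_normal_of_sectionOneFacts` — under the capstone's named §1 facts plus `μ_l ⊆ K`,
  there is a choice `X̲̲` (a `DoubleUnderline`) with `Π^tp_X̲̲ ⊴ Π^tp_X̲`.

Nothing of [EtTh] is asserted; typed ≠ endorsed; no side is taken on any disputed claim.
-/

noncomputable section

namespace Literature.AnabelianGeometry.EtaleTheta

open Literature.AnabelianGeometry.SemiGraphs
open scoped IsMulCommutative

namespace ThetaSetting

variable {p : ℕ} [Fact p.Prime] {D : ThetaSetting p}

/-! ### `μ_N ⊆ K`: the cyclotomic character of `G_K` is trivial -/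

/-- **`μ_N ⊆ K` ⇒ `G_K` fixes `μ_N`**: every `σ ∈ Π^tp_X` (acting on `K̄` through `aug(σ) ∈ G_K`) fixes
every `N`-th root of unity. [cite: MochizukiEtTh2009, Rmk 2.6.1 p.40] -/
theorem galMuN_aug_eq_self_of_muN_subset {N : ℕ+}
    (hμK : ∀ ζ : MuN p N, (((ζ : (PadicAlgCl p)ˣ) : PadicAlgCl p)) ∈ D.K) (σ : D.PiTemp)
    (ζ : MuN p N) : galMuN p N (D.aug.toMonoidHom σ) ζ = ζ := by
  have hσ : D.aug.toMonoidHom σ ∈ D.GK := D.aug_mem_GK σ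
  have hfix := (IntermediateField.mem_fixingSubgroup_iff _ _).mp hσ _ (hμK ζ)
  apply Subtype.ext
  apply Units.ext
  rw [galMuN_apply_coe]
  exact hfix

/-- **`μ_l ⊆ K` ⇒ `Π^tp_X` acts trivially on `Δ̄_Θ = Δ_Θ/l·Δ_Θ`**: for `σ ∈ Π^tp_X` and `a ∈ Δ_Θ`,
`σ̄ a σ̄⁻¹ a⁻¹ ∈ l·Δ_Θ` — through the `G_K`-equivariant cyclotome identification `Δ_Θ/l ≅ μ_l`
(`CyclotomeMod 1 l`, field `red_conj`). [cite: MochizukiEtTh2009, Rmk 2.6.1 p.40] -/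
theorem conj_mul_inv_mem_lDeltaTheta_of_muN_subset {l : ℕ+} (μ : D.CyclotomeMod 1 l)
    (hμK : ∀ ζ : MuN p l, (((ζ : (PadicAlgCl p)ˣ) : PadicAlgCl p)) ∈ D.K) (σ : D.PiTemp)
    (a : D.DeltaTheta) :
    D.toTheta σ * a * (D.toTheta σ)⁻¹ * (a : D.GtpTheta)⁻¹ ∈ D.lDeltaTheta l := by
  have hconj : D.toTheta σ * a * (D.toTheta σ)⁻¹ ∈ D.DeltaTheta :=
    D.deltaTheta_normal.conj_mem _ a.2 _
  have key : redOne μ ⟨_, hconj⟩ = redOne μ a := by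
    rw [redOne_apply, redOne_apply]
    have e := μ.red_conj σ ⟨(a : D.GtpTheta), D.lDeltaTheta_one.symm ▸ a.2⟩
    rw [galMuN_aug_eq_self_of_muN_subset hμK] at e
    exact e
  have hmem : (⟨_, hconj⟩ : D.DeltaTheta) * a⁻¹ ∈ (redOne μ).ker := by
    rw [MonoidHom.mem_ker, map_mul, map_inv, key, mul_inv_cancel]
  rw [ker_redOne μ, Subgroup.mem_subgroupOf] at hmem
  exact hmem

namespace EtaleThetaData

variable {E : D.EtaleThetaData}

namespace XuuCocycleData

variable {l : ℕ} (Ξ : XuuCocycleData E l)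

/-! ### Trivial action on `Δ̄_Θ`: the cocycle is a homomorphism, its zero set is normal -/

/-- If `σ̄ a σ̄⁻¹ a⁻¹ ∈ l·Δ_Θ` for all `a ∈ Δ_Θ`, then `σ` acts trivially on `Δ̄_Θ = Δ_Θ/l·Δ_Θ`.
[cite: MochizukiEtTh2009, Rmk 2.6.1 p.40] -/
theorem actBar_eq_self_of_conj_mem {σ : D.PiTemp}
    (hσ : ∀ a : D.DeltaTheta, D.toTheta σ * a * (D.toTheta σ)⁻¹ * (a : D.GtpTheta)⁻¹ ∈ D.lDeltaTheta l)
    (u : DeltaThetaModL D l) : actBar D l (D.toTheta σ) u = u := by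
  induction u using QuotientGroup.induction_on with
  | H a =>
    rw [actBar_mk, QuotientGroup.eq, Subgroup.mem_subgroupOf]
    have h1 : (((MulAut.conjNormal (D.toTheta σ) a * a⁻¹ : D.DeltaTheta)) : D.GtpTheta) ∈
        D.lDeltaTheta l := by
      rw [Subgroup.coe_mul, Subgroup.coe_inv, MulAut.conjNormal_apply]
      exact hσ a
    have e : (MulAut.conjNormal (D.toTheta σ) a)⁻¹ * a = (MulAut.conjNormal (D.toTheta σ) a * a⁻¹)⁻¹ := by
      rw [mul_inv_rev, inv_inv, mul_comm]
    rw [e, Subgroup.coe_inv]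
    exact inv_mem h1

/-- Under a trivial action of `Π^tp_X̲` on `Δ̄_Θ`, the reduced cocycle `F̄` is a homomorphism.
[cite: MochizukiEtTh2009, Rmk 2.6.1 p.40] -/
theorem Fbar_mul_of_triv
    (htriv : ∀ (σ : ↥(D.GtpXu l)) (u : DeltaThetaModL D l), actBar D l (D.toTheta (σ : D.PiTemp)) u = u)
    (g h : ↥(D.GtpXu l)) : Ξ.Fbar (g * h) = Ξ.Fbar g * Ξ.Fbar h := by
  rw [Fbar_mul, htriv]

/-- **The zero set `Π^tp_X̲̲` of the cocycle is NORMAL in `Π^tp_X̲`** when `Π^tp_X̲` acts trivially on `Δ̄_Θ`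
(it is then the kernel of the homomorphism `F̄`). [cite: MochizukiEtTh2009, Rmk 2.6.1 p.40] -/
theorem Huu0_normal_of_triv
    (htriv : ∀ (σ : ↥(D.GtpXu l)) (u : DeltaThetaModL D l), actBar D l (D.toTheta (σ : D.PiTemp)) u = u) :
    Ξ.Huu0.Normal := by
  refine ⟨fun g hg h => ?_⟩
  change Ξ.Fbar g = 1 at hg
  change Ξ.Fbar (h * g * h⁻¹) = 1
  rw [Ξ.Fbar_mul_of_triv htriv, Ξ.Fbar_mul_of_triv htriv, hg, mul_one, ← Ξ.Fbar_mul_of_triv htriv,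
    mul_inv_cancel, Fbar_one]

/-- `Π^tp_X̲̲ ⊆ Π^tp_X` read back inside `Π^tp_X̲` is the zero set. [cite: MochizukiEtTh2009, Def 2.7 p.41] -/
theorem Huu_subgroupOf : Ξ.Huu.subgroupOf (D.GtpXu l) = Ξ.Huu0 :=
  Subgroup.comap_map_eq_self_of_injective (D.GtpXu l).subtype_injective _

/-- The `DoubleUnderline` assembled from the cocycle data (`Ξ.doubleUnderline`) has
`Π^tp_X̲̲ ⊴ Π^tp_X̲` when `Π^tp_X̲` acts trivially on `Δ̄_Θ`. [cite: MochizukiEtTh2009, Rmk 2.6.1 p.40] -/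
theorem doubleUnderline_normal_of_triv
    (htriv : ∀ (σ : ↥(D.GtpXu l)) (u : DeltaThetaModL D l), actBar D l (D.toTheta (σ : D.PiTemp)) u = u) :
    (Ξ.doubleUnderline.Huu.subgroupOf (D.GtpXu l)).Normal := by
  change (Ξ.Huu.subgroupOf (D.GtpXu l)).Normal
  rw [Ξ.Huu_subgroupOf]
  exact Ξ.Huu0_normal_of_triv htriv

end XuuCocycleData

/-- **`μ_l ⊆ K` ⇒ the constructed `X̲̲ → X̲` is Galois**: for every cocycle datum `Ξ` (orientation `e`
arbitrary) the assembled `DoubleUnderline` satisfies `Π^tp_X̲̲ ⊴ Π^tp_X̲` as soon as `K` contains the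
`l`-th roots of unity (Rmk. 2.6.1: "Suppose, for simplicity, that `K` contains a primitive `l`-th root of
unity. Then … `Aut_K(X̲̲^log) = μ_l × {±1}`"), via the `G_K`-equivariant cyclotome identification
`Δ_Θ/l ≅ μ_l`. [cite: MochizukiEtTh2009, Rmk 2.6.1 p.40] -/
theorem XuuCocycleData.doubleUnderline_normal_of_muL {l : ℕ+} (Ξ : XuuCocycleData E l)
    (μ : D.CyclotomeMod 1 l) (hμK : ∀ ζ : MuN p l, (((ζ : (PadicAlgCl p)ˣ) : PadicAlgCl p)) ∈ D.K) :
    (Ξ.doubleUnderline.Huu.subgroupOf (D.GtpXu l)).Normal :=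
  Ξ.doubleUnderline_normal_of_triv fun σ u =>
    XuuCocycleData.actBar_eq_self_of_conj_mem
      (fun a => conj_mul_inv_mem_lDeltaTheta_of_muN_subset μ hμK (σ : D.PiTemp) a) u

/-- The same for the `DoubleUnderline` from the printed inputs (`doubleUnderlineOfCyclotomeMod`, `e = 1`).
[cite: MochizukiEtTh2009, Rmk 2.6.1 p.40] -/
theorem doubleUnderlineOfCyclotomeMod_normal_of_muL {l : ℕ+} (hS : D.Sec2Hyps)
    (μ : D.CyclotomeMod 1 l) (hl : Odd (l : ℕ)) (I : E.XuuCocycleInput l)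
    (hμK : ∀ ζ : MuN p l, (((ζ : (PadicAlgCl p)ˣ) : PadicAlgCl p)) ∈ D.K) :
    ((doubleUnderlineOfCyclotomeMod hS μ hl I).Huu.subgroupOf (D.GtpXu l)).Normal :=
  (XuuCocycleData.ofCyclotomeMod hS μ hl I).doubleUnderline_normal_of_muL μ hμK

/-- **A Galois choice `X̲̲` exists from the named §1 facts plus `μ_l ⊆ K`** — the binder `hN`
("`Π^tp_X̲̲ ⊴ Π^tp_X̲`") of seat abc-iut-L6-t19's Rmk. 2.3.1 chain, realised at a constructed `X̲̲`: under
`Compat`, `K = K̈`, `IsEtThOrigin`, `Prop15iii`, `Prop15ii`, `CyclotomeMod 1 l`, `l` odd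
(`nonempty_xuuCocycleInput_of_sectionOneFacts`) and `μ_l ⊆ K`, there is a `DoubleUnderline` whose
`Π^tp_X̲̲` is normal in `Π^tp_X̲`. [cite: MochizukiEtTh2009, Rmk 2.6.1 p.40] -/
theorem exists_doubleUnderline_normal_of_sectionOneFacts (hC : D.Compat) (hS : D.Sec2Hyps)
    (hO : D.IsEtThOrigin) (h15 : Prop15iii E hC) (h15ii : Prop15ii E.toKummerData hC) {l : ℕ+}
    (μ : D.CyclotomeMod 1 l) (hl : Odd (l : ℕ))
    (hμK : ∀ ζ : MuN p l, (((ζ : (PadicAlgCl p)ˣ) : PadicAlgCl p)) ∈ D.K) :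
    ∃ C : E.DoubleUnderline l, (C.Huu.subgroupOf (D.GtpXu l)).Normal := by
  obtain ⟨I⟩ := nonempty_xuuCocycleInput_of_sectionOneFacts hC hS hO h15 h15ii μ hl
  exact ⟨doubleUnderlineOfCyclotomeMod hS μ hl I, doubleUnderlineOfCyclotomeMod_normal_of_muL hS μ hl I hμK⟩

end EtaleThetaData

end ThetaSetting

end Literature.AnabelianGeometry.EtaleTheta

end
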